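import Literature.Analysis.FluidPDE.LagrangianLatticeCarrierFrame
import Literature.Analysis.FluidPDE.PassiveVectorTensorPropagatorLossMonotone
import HarnessLib

/-!
# The coarse drift of a Lagrangian lattice carrier is a smooth carrier; loss-rate monotonicity of its propagator

Analysis/FluidPDE proof-support file (theorems only; no named facts), joining `LagrangianLatticeCarrierFrame` (regularity of
the partial sums `b_{≤m} = b 1 + ⋯ + b m` of a Lagrangian lattice carrier with `LevelRegular` data: jointly continuous, smooth
and divergence-free slices, space derivatives bounded uniformly in time) to `PassiveVectorTensorPropagatorLossMonotone`
(loss-rate monotonicity of the passive-vector propagator along a `Torus.SmoothCarrier`):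

* `LevelRegular.smoothCarrier_partialSum` — given a uniform gradient bound `|∂_c (b_{≤m})_a| ≤ G` (the design-specific
  `G = C'·Σ_{i<m} a(i+1)` is supplied by the using route), `b_{≤m}` is a `Torus.SmoothCarrier b_{≤m} M G` for some `M`;
* `LevelRegular.loss_window_le` — for the solution propagator `U` of `∂ₜw + (b_{≤m}·∇)w + ∇π = 𝓛_𝔹 w` (`IsPropagator T b_{≤m} 𝔹 U`,
  `NearIso 𝔹 lo hi`, `0 < lo`) and a window `[t₁, t₁ + R] ∪ [t₁ + R, s']`, `s' ≤ t₁ + 2R`, `s' ≤ T`: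
  `‖U t₁ (t₁+R) x‖² − ‖U (t₁+R) s' (U t₁ (t₁+R) x)‖² ≤ (|hi|/lo)·e^{12·G·R}·((s' − (t₁+R))/R)·(‖x‖² − ‖U t₁ (t₁+R) x‖²)`
  — the shape of the (N2) conjunct of `cellInputs_alphaBeta_text` (K1L_D `stmt-AnomalousDissipation-27980`, `stub_Z7_alphaBeta`,
  cell `ad-ideate`; there `t₁ = jR`, `R = refresh (m+1)`, and `G·R ≤ C'·strain m ≤ C'·θ₀` makes the constant uniform).

## References

* S. Armstrong, V. Vicol, *Anomalous diffusion by fractal homogenization*, Ann. PDE 11 (2025), §2.2 (PDF p. 18), §5.1. [`ArmstrongVicol2025`]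
* R. Temam, *Navier–Stokes Equations*, 3rd ed. (1984), Ch. III §2 (3.41)–(3.47). [`Temam1984`]
* P. Constantin, C. Foias, *Navier–Stokes Equations* (1988), Ch. 10. [`ConstantinFoias1988`]
-/

noncomputable section

open Set Filter Topology Function MeasureTheory
open scoped NNReal InnerProductSpace

namespace Literature.Analysis.FluidPDE.LatticeShear

namespace LagrangianLatticeCarrier

open Literature.Analysis.FunctionSpaces Literature.Analysis.FunctionSpaces.Torus Literature.Analysis.FluidPDE.Torus

variable {k : ℕ} {E : LagrangianLatticeCarrier k}

/-- **The coarse drift `b_{≤m}` is a smooth carrier**: with `LevelRegular` data and a uniform gradient bound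
`|∂_c (b_{≤m}(t))_a (x)| ≤ G` (`G ≥ 0`), there is `M` with `Torus.SmoothCarrier (E.partialSum m) M G` (joint continuity, smooth
divergence-free slices and the sup bound from `LagrangianLatticeCarrierFrame`). [cite: ArmstrongVicol2025, §2.2 (PDF p. 18: the b_m are smooth, divergence free)] -/
theorem LevelRegular.smoothCarrier_partialSum (h : E.LevelRegular) (m : ℕ) {G : ℝ} (hG0 : 0 ≤ G)
    (hG : ∀ (t : ℝ) (x : UnitAddTorus (Fin 3)) (c a : Fin 3),
      |FunctionSpaces.Torus.partialDeriv c (E.partialSum m t) x a| ≤ G) :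
    ∃ M : ℝ, Torus.SmoothCarrier (E.partialSum m) M G := by
  obtain ⟨C, hC⟩ := h.exists_norm_iteratedFDeriv_partialSum_le m 0
  refine ⟨C, ⟨h.continuous_uncurry_partialSum m, fun t => h.isSmooth_partialSum m t, fun t => h.isDivFree_partialSum m t,
    fun t x => ?_, hG0, hG⟩⟩
  have h0 := hC t (repr x)
  rw [norm_iteratedFDeriv_zero, lift_apply, proj_repr] at h0
  exact h0

/-- **Loss-rate monotonicity of the coarse propagator on a refresh window** (the (N2) shape). For `LevelRegular` data, a uniform
gradient bound `|∂ b_{≤m}| ≤ G`, the solution propagator `IsPropagator T (E.partialSum m) 𝔹 U` of an elliptic constant tensor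
(`NearIso 𝔹 lo hi`, `0 < lo`), a window start `t₁ ≥ 0`, a length `R > 0` and an end time `s' ∈ [t₁ + R, t₁ + 2R]`, `s' ≤ T`, every `x ∈ L²`:
`‖U t₁ (t₁+R) x‖² − ‖U (t₁+R) s' (U t₁ (t₁+R) x)‖² ≤ (|hi|/lo)·e^{12·G·R}·((s' − (t₁+R))/R)·(‖x‖² − ‖U t₁ (t₁+R) x‖²)`
(`IsPropagator.loss_window_le` with `#(Fin 3) = 3`). [cite: Temam1984, Ch. III §2 (3.41)–(3.47)] [cite: ConstantinFoias1988, Ch. 10] -/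
theorem LevelRegular.loss_window_le (h : E.LevelRegular) (m : ℕ) {G : ℝ} (hG0 : 0 ≤ G)
    (hG : ∀ (t : ℝ) (x : UnitAddTorus (Fin 3)) (c a : Fin 3),
      |FunctionSpaces.Torus.partialDeriv c (E.partialSum m t) x a| ≤ G)
    {𝔹 : Torus.Visc4 (Fin 3)} {lo hi : ℝ} (h𝔹 : Torus.NearIso 𝔹 lo hi) (hlo : 0 < lo) {T : ℝ}
    {U : ℝ → ℝ → (Lp (EuclideanSpace ℝ (Fin 3)) 2 (volume : Measure (UnitAddTorus (Fin 3))) →L[ℝ]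
      Lp (EuclideanSpace ℝ (Fin 3)) 2 (volume : Measure (UnitAddTorus (Fin 3))))}
    (hU : Torus.IsPropagator T (E.partialSum m) 𝔹 U) {t₁ R s' : ℝ} (ht₁ : 0 ≤ t₁) (hR : 0 < R) (h₁ : t₁ + R ≤ s')
    (h₂ : s' ≤ t₁ + 2 * R) (hs'T : s' ≤ T) (x : Lp (EuclideanSpace ℝ (Fin 3)) 2 (volume : Measure (UnitAddTorus (Fin 3)))) :
    ‖U t₁ (t₁ + R) x‖ ^ 2 - ‖U (t₁ + R) s' (U t₁ (t₁ + R) x)‖ ^ 2 ≤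
      (|hi| / lo * Real.exp (12 * G * R)) * ((s' - (t₁ + R)) / R) * (‖x‖ ^ 2 - ‖U t₁ (t₁ + R) x‖ ^ 2) := by
  obtain ⟨M, hb⟩ := h.smoothCarrier_partialSum m hG0 hG
  have key := hU.loss_window_le h𝔹 hlo hb ht₁ hR h₁ h₂ hs'T x
  have e : 4 * ((Fintype.card (Fin 3) : ℝ) * G) * R = 12 * G * R := by
    rw [Fintype.card_fin]; push_cast; ring
  rw [e] at key
  exact key

end LagrangianLatticeCarrier

end Literature.Analysis.FluidPDE.LatticeShear
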